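import Summits.BirchSwinnertonDyer.BirchSwinnertonDyer.Theorems.SemiOrdinaryEisensteinDescentShaTwoCochainShell
import Summits.BirchSwinnertonDyer.BirchSwinnertonDyer.Theorems.SemiOrdinaryEisensteinDescentShaTwoCochainBridgeAssemblyCriterion
import Summits.BirchSwinnertonDyer.BirchSwinnertonDyer.Theorems.SemiOrdinaryEisensteinDescentShaTwoCochainClassReadout
import Summits.BirchSwinnertonDyer.BirchSwinnertonDyer.Theses.SemiOrdinaryEisensteinDescent
import Summits.BirchSwinnertonDyer.BirchSwinnertonDyer.Theses.KolyvaginRoadThree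
import Summits.BirchSwinnertonDyer.BirchSwinnertonDyer.Theses.ClassRecordThree
import Summits.BirchSwinnertonDyer.BirchSwinnertonDyer.Theses.ErratumRoadFive
import HarnessLib

/-!
# `casselsTate_levelInputs K` for EVERY number field `K` — the levelwise Cassels–Tate fact for THE canonical invariant maps —
# and the four route binders it IS (stmt-BirchSwinnertonDyer-20191): SOED `CasselsTateLevelInputsFact`, KR3 / CR3 / ER5
# `ShimuraCasselsTateLevelInputs`

Item stmt-BirchSwinnertonDyer-20191 (`∀ (K : Type) [Field K] [NumberField K], casselsTate_levelInputs K`; the printed input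
"levelwise Cassels–Tate inputs" of the Kolyvagin columns: Milne ADT I §6 cochain recipe + reciprocity + `Ш³(K, μ) = 0` + local
duality + functoriality, shared by the routes SemiOrdinaryEisensteinDescent (crux `KolyvaginPrimitivesAtThree` conjunct 1, binder
`hPr`; aside `WildKolyvaginUpperAtThree` stub_inputsPrim), KolyvaginRoadThree / ClassRecordThree / ErratumRoadFive (binders
`hCT`/`hCT3`/`hCTi`)) — CLOSED here by composing the Ш²-cochain bridge of cell bsd-wall's SOED Kolyvagin-column width seats
(memo `Cruxes/WildKolyvaginUpperAtThree/SHA2-BRIDGE-w3g7.md`; w3 g7, w2 g11, w5 g2/g6/g7, w3 g8, w4 g2; 30+ helper files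
`Theorems/SemiOrdinaryEisensteinDescentShaTwoCochain*.lean` + `…CasselsTate*.lean`):

  `casselsTate_levelInputs K`
    ⟸ `hPTc` — Milne I 4.10 (a) for `Ш²(K, E[p^{M₀}])` in `PTChoice` cochain form (w3 g6 `CasselsTateConj.casselsTate_levelInputs_of_shaTwoCochain`,
       all other inputs — reciprocity, `Ш³ = 0`, local duality, Lemma 6.15, `Aut`-invariance, Howard's complement property of THE
       maps (cell bsd-schneider door-c4) — being tree theorems)
    ⟸ the shell `ShaTwoCochainTheta.casselsTate_levelInputs_of_readout_vanishing_flip` (θ′ = desc^♭ flipped; exhaustion of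
       `Ш²(K, E[m]^D)` by road B's `Ψ = shaTwoConnecting`; readout-injectivity threading)
    ⟸ `ShaTwoCochainTheta.hbridge_of_readout_criterion` (the bridge: explicit admissible choice from `Ψ h`, transport, choice
       independence, local currency, the idèle cocycle `Z`, vanishing finite invariant sums, vanishing archimedean classes at odd level)
    ⟸ `ShaTwoCochain.classBarInv_readout_eq_zero_of_criterion` (road B's global invariant sum: layer descent of `Z`, the two
       identifications of `(j_C)_* [Z]`, layer independence of `classInvAll`, Brauer–Hasse–Noether/Tate `inv = Σ_v inv_v`).

* `casselsTate_levelInputs_of_shaTwoCochainBridge` — `casselsTate_levelInputs K` at every number field `K` (one line);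
* `CasselsTateLevelInputsFact_proof : Summit.….Theses.SemiOrdinaryEisensteinDescent.CasselsTateLevelInputsFact`;
* `KolyvaginRoadThree.ShimuraCasselsTateLevelInputs_proof`, `ClassRecordThree.ShimuraCasselsTateLevelInputs_proof`,
  `ErratumRoadFive.ShimuraCasselsTateLevelInputs_proof` — the same statement under the three other routes' names.

HONEST FRAMING.  THEOREMS ONLY (no definition, no instance, no named fact, no `sorry`).  This discharges a PUBLISHED input
(Milne, *Arithmetic Duality Theorems* I §6 / Thm. 4.10; Cassels 1962; Tate 1962) in the kernel for THE canonical local invariant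
maps; it proves NO case of BSD and changes no research content of the routes (their cruxes are elsewhere); BSD is not proved by
any of this.  Width seat `bsd-wall-soed-p2-w4` g2 (closer owner of the lane); `--workitem stmt-BirchSwinnertonDyer-20191`.

## References
* [MilneADT2006] J. S. Milne, *Arithmetic Duality Theorems*, 2nd ed. (2006), Ch. I Thm. 4.10 (a)–(c), Lemma 4.13, §6 Prop. 6.9,
  Thm. 6.13 (a)(b), Lemmas 6.15–6.17.
* [Cassels1962ArithmeticIV] J. W. S. Cassels, *Arithmetic on curves of genus 1, IV. Proof of the Hauptvermutung*, J. reine angew.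
  Math. 211 (1962), 95–112.
* [Tate1963DualityICM] J. Tate, *Duality theorems in Galois cohomology over number fields*, Proc. ICM Stockholm 1962, 288–295.
* [CasselsFrohlichANT1967] J. W. S. Cassels, A. Fröhlich (eds.), *Algebraic Number Theory* (1967), Ch. VII §9–§11.
* [McCallumLMS1991] W. G. McCallum, *Kolyvagin's work on Shafarevich–Tate groups* (1991), §5, Thms. 5.4, 5.8.
-/

noncomputable section

-- `Summit.<P>.<Sub>` repeats `BirchSwinnertonDyer` by the tree's layout convention (D-0017)
set_option linter.dupNamespace false
set_option autoImplicit false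

namespace Summit.BirchSwinnertonDyer.BirchSwinnertonDyer.Theorems.ShaTwoCochainTheta

open Literature.NumberTheory.EllipticCurves

/-- **The levelwise Cassels–Tate fact for THE canonical invariant maps, at every number field `K`** (Milne ADT I §6: the
Cassels–Tate pairing at the levels `p^{M₀}`, `p` odd, exists with the printed properties for `LocalInvariants.canonical`): the
composition of the Ш²-cochain bridge — see the module docstring for the chain and its authors.
[cite: MilneADT2006, Ch. I, Thm. 4.10 (a), §6 Prop. 6.9, Thm. 6.13 (a)][cite: Cassels1962ArithmeticIV][cite: Tate1963DualityICM, Thm. 3.1]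
[cite: CasselsFrohlichANT1967, Ch. VII §11.2 (bis)] -/
theorem casselsTate_levelInputs_of_shaTwoCochainBridge (K : Type) [Field K] [NumberField K] :
    casselsTate_levelInputs K :=
  casselsTate_levelInputs_of_readout_vanishing_flip K
    (hbridge_of_readout_criterion K (ShaTwoCochain.classBarInv_readout_eq_zero_of_criterion K))

/-- **Item stmt-BirchSwinnertonDyer-20191 for route SemiOrdinaryEisensteinDescent, BY NAME**: `CasselsTateLevelInputsFact`
(`= ∀ K, casselsTate_levelInputs K`; conjunct 1 of `KolyvaginPrimitivesAtThree`, the `closes` binder `hPr`).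
[cite: MilneADT2006, Ch. I, §6 Prop. 6.9, Thm. 6.13 (a)][cite: McCallumLMS1991, §5, Thm. 5.4, Thm. 5.8] -/
theorem CasselsTateLevelInputsFact_proof :
    Summit.BirchSwinnertonDyer.BirchSwinnertonDyer.Theses.SemiOrdinaryEisensteinDescent.CasselsTateLevelInputsFact :=
  fun K _ _ => casselsTate_levelInputs_of_shaTwoCochainBridge K

/-- **The same statement under route KolyvaginRoadThree's name `ShimuraCasselsTateLevelInputs`** (binder `hCT3`).
[cite: MilneADT2006, Ch. I, §6 Prop. 6.9, Thm. 6.13 (a)][cite: GrossLMS1991, §5 (5.1)] -/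
theorem KolyvaginRoadThree.ShimuraCasselsTateLevelInputs_proof :
    Summit.BirchSwinnertonDyer.BirchSwinnertonDyer.Theses.KolyvaginRoadThree.ShimuraCasselsTateLevelInputs :=
  fun K _ _ => casselsTate_levelInputs_of_shaTwoCochainBridge K

/-- **The same statement under route ClassRecordThree's name `ShimuraCasselsTateLevelInputs`** (binder `hCT3`).
[cite: MilneADT2006, Ch. I, §6 Prop. 6.9, Thm. 6.13 (a)][cite: GrossLMS1991, §5 (5.1)] -/
theorem ClassRecordThree.ShimuraCasselsTateLevelInputs_proof :
    Summit.BirchSwinnertonDyer.BirchSwinnertonDyer.Theses.ClassRecordThree.ShimuraCasselsTateLevelInputs :=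
  fun K _ _ => casselsTate_levelInputs_of_shaTwoCochainBridge K

/-- **The same statement under route ErratumRoadFive's name `ShimuraCasselsTateLevelInputs`** (binder `hCTi`).
[cite: MilneADT2006, Ch. I, §6 Prop. 6.9, Thm. 6.13 (a)][cite: GrossLMS1991, §5 (5.1)] -/
theorem ErratumRoadFive.ShimuraCasselsTateLevelInputs_proof :
    Summit.BirchSwinnertonDyer.BirchSwinnertonDyer.Theses.ErratumRoadFive.ShimuraCasselsTateLevelInputs :=
  fun K _ _ => casselsTate_levelInputs_of_shaTwoCochainBridge K

end Summit.BirchSwinnertonDyer.BirchSwinnertonDyer.Theorems.ShaTwoCochainTheta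

end
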